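import Summits.Langlands.Langlands.Theorems.ParityBlindBianchiTwoAdicBianchiProModularityLevelSqueezeDefs
import Summits.Langlands.Langlands.Theorems.ParityBlindBianchiResidualBianchiDoorLevelResidual
import Literature.NumberTheory.GaloisRepresentations.PolarizedDeformationRing
import Literature.NumberTheory.GaloisRepresentations.PolarizedDeformationRingProofs
import Literature.NumberTheory.GaloisRepresentations.PadicCoeffRingDVRProofs
import Literature.NumberTheory.GaloisRepresentations.StableLatticeValuationRing
import Literature.NumberTheory.GaloisRepresentations.ReductionKernelTorsion
import Literature.NumberTheory.GaloisRepresentations.ArtinRestriction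
import Literature.RepresentationTheory.Semisimple.BurnsideMatrixSpan
import HarnessLib

/-!
# Stub `stub_setup` of line `dimension-squeeze` (crux stmt-Langlands-15110
# `ParityBlindBianchi.TwoAdicBianchiProModularityLevel`): integral model and universal ring

For a continuous `σ : Γ_K → GL₂(ℚ̄₂)` with finite image and projective image `A₅` we construct a
`Model σ` (vocabulary of `ParityBlindBianchiTwoAdicBianchiProModularityLevelSqueezeDefs.lean`) and
prove that Mazur's universal deformation ring of its reduction exists:

* a `Γ_K`-stable lattice gives `P` and `ρ₀ : Γ_K → GL₂(ℤ̄₂)` with `ρ₀ = P⁻¹ σ P`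
  (`exists_integralModel_of_valuationSubring`, Serre I.1.1); the finitely many matrices
  `P⁻¹ σ(g) P` have entries in a finite extension `E/ℚ₂`, so `ρ₀` is valued in `GL₂(𝒪_E)`,
  `𝒪_E = padicCoeffRing E` a complete discrete valuation ring, finite over `ℤ₂`
  (`moduleFinite_padicCoeffRing`) with finite residue field (`finite_residueField_padicCoeffRing`);
* `ker σ_𝒪 = ker σ` is open (finite image, Hausdorff target), hence so is the residual kernel;
* the reduction `σ̄` of the projectively icosahedral `σ_𝒪` is ABSOLUTELY irreducible
  (`isIrreducible_toStdRepresentation_map_comp` along every `𝒪 → k → L`, `3 ∈ 𝒪ˣ`), so by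
  Burnside the `σ̄(γ)` span `M₂(k)` and `σ̄` has scalar centralizer (Schur), and the tree's PROVED
  `polarizedDeformationRing_nonempty_holds` yields the universal ring.
-/

noncomputable section

set_option linter.dupNamespace false -- `Summit.Langlands.Langlands` is the mandated namespace (D-0017)

open scoped NumberField MatrixGroups NNReal
open IsDedekindDomain Field
open Literature.NumberTheory.GaloisRepresentations
open Summit.Langlands.Langlands.Cruxes.ResidualBianchiDoorLevel.Sketch

namespace Summit.Langlands.Langlands.Cruxes.TwoAdicBianchiProModularityLevel.DimensionSqueeze

/-! ### Group theory: change of coefficients -/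

section GroupTheory

variable {A F : Type*} [CommRing A] [CommRing F] {G : Type*} [Group G]

/-- **Icosahedral type is invariant under an injective change of coefficients and conjugation**:
if `GL₂(f)(ρ₀ g) = P⁻¹ ρ(g) P` for all `g` with `f` injective, then `ρ₀` is projectively
icosahedral as soon as `ρ` is (`PGL₂(f)` is injective, conjugation is an automorphism of
`PGL₂`). [folklore] -/
theorem isIcosahedralType_of_map_eq_conj (f : A →+* F) (hf : Function.Injective f)
    (ρ : G →* GL (Fin 2) F) (ρ₀ : G →* GL (Fin 2) A) (P : GL (Fin 2) F)
    (h : ∀ g, Matrix.GeneralLinearGroup.map f (ρ₀ g) = P⁻¹ * ρ g * P)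
    (hρ : IsIcosahedralType ρ) : IsIcosahedralType ρ₀ := by
  have heq : (Matrix.GeneralLinearGroup.map f).comp ρ₀ = conjGL P⁻¹ ρ := by
    ext1 g
    rw [MonoidHom.comp_apply, h g, conjGL_apply, inv_inv]
  obtain ⟨e⟩ := hρ
  obtain ⟨e'⟩ := LocalRingReduction.nonempty_projectiveImage_comp_mulEquiv_of_injOn f ρ₀
    (projGenLinGroup_map_injective_of_injective f hf).injOn
  rw [heq] at e'
  exact ⟨e'.symm.trans ((projectiveImageConjEquiv P⁻¹ ρ).symm.trans e)⟩

/-- A matrix `g ∈ GL_n(F)` all of whose entries, and whose inverse's entries, lie in the image of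
an injective `f : A → F` comes from `GL_n(A)`. [folklore] -/
theorem mem_range_generalLinearGroup_map_of_forall {n : Type*} [Fintype n] [DecidableEq n]
    {f : A →+* F} (hf : Function.Injective f) {g : GL n F}
    (h1 : ∀ i j, (g : Matrix n n F) i j ∈ Set.range f)
    (h2 : ∀ i j, ((g⁻¹ : GL n F) : Matrix n n F) i j ∈ Set.range f) :
    g ∈ (Matrix.GeneralLinearGroup.map f).range := by
  choose a ha using h1
  choose b hb using h2
  have hA : (Matrix.of a).map f = (g : Matrix n n F) := by
    ext i j; exact ha i j
  have hB : (Matrix.of b).map f = ((g⁻¹ : GL n F) : Matrix n n F) := by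
    ext i j; exact hb i j
  have hinj : Function.Injective fun M : Matrix n n A => M.map f := Matrix.map_injective hf
  have hAB : Matrix.of a * Matrix.of b = 1 := hinj (by
    change (Matrix.of a * Matrix.of b).map f = (1 : Matrix n n A).map f
    rw [Matrix.map_mul, hA, hB, Matrix.map_one f (map_zero f) (map_one f), ← Units.val_mul,
      mul_inv_cancel, Units.val_one])
  have hBA : Matrix.of b * Matrix.of a = 1 := hinj (by
    change (Matrix.of b * Matrix.of a).map f = (1 : Matrix n n A).map f
    rw [Matrix.map_mul, hA, hB, Matrix.map_one f (map_zero f) (map_one f), ← Units.val_mul,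
      inv_mul_cancel, Units.val_one])
  exact ⟨⟨Matrix.of a, Matrix.of b, hAB, hBA⟩, Units.ext hA⟩

/-- A homomorphism `G → GL_n(F)` with values in the image of `GL_n(A)`, `f : A → F` injective,
lifts to a homomorphism `G → GL_n(A)` (the tree's `exists_monoidHom_map_eq` for an arbitrary
injective change of coefficients). [folklore] -/
theorem exists_monoidHom_map_eq_of_injective {n : Type*} [Fintype n] [DecidableEq n]
    (f : A →+* F) (hf : Function.Injective f) (φ : G →* GL n F)
    (hφ : ∀ g, φ g ∈ (Matrix.GeneralLinearGroup.map f).range) :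
    ∃ φ₀ : G →* GL n A, ∀ g, Matrix.GeneralLinearGroup.map f (φ₀ g) = φ g := by
  have hinj : Function.Injective (Matrix.GeneralLinearGroup.map (n := n) f) :=
    generalLinearGroup_map_injective_of_injective f hf
  refine ⟨(MonoidHom.ofInjective hinj).symm.toMonoidHom.comp (φ.codRestrict _ hφ), fun g => ?_⟩
  rw [MonoidHom.comp_apply, MulEquiv.coe_toMonoidHom, MonoidHom.apply_ofInjective_symm hinj]
  rfl

/-- A ring homomorphism `O → k → L` (`O` local, `O → k` onto a field, `k → L` a field
homomorphism) is a local homomorphism: its kernel is the maximal ideal. [folklore] -/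
theorem isLocalHom_comp_of_surjective {O k L : Type*} [CommRing O] [IsLocalRing O] [Field k]
    [Field L] (π : O →+* k) (hπ : Function.Surjective π) (f : k →+* L) :
    IsLocalHom (f.comp π) := by
  refine ⟨fun x hx => ?_⟩
  by_contra hxu
  have hxm : x ∈ RingHom.ker π := by
    rw [IsLocalRing.ker_eq_maximalIdeal π hπ]
    exact hxu
  rw [RingHom.mem_ker] at hxm
  rw [RingHom.comp_apply, hxm, map_zero] at hx
  exact not_isUnit_zero hx

end GroupTheory

/-! ### Schur for projectively icosahedral reductions -/

/-- **Scalar centralizer from the icosahedral projective image.**  If the residual representation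
of a polarized datum is the reduction `π ∘ ρ₀` of a projectively icosahedral `ρ₀ : Γ_F → GL₂(𝒪)`
with `3 ∈ 𝒪ˣ`, then it is absolutely irreducible — its extension of scalars along any field
homomorphism `f : k → L` is the reduction of `ρ₀` along the local homomorphism `f ∘ π`, still
projectively `A₅`, and a reducible two-dimensional representation has solvable image — hence by
Burnside the `r̄(γ)` span `M₂(k)` and `r̄` has scalar centralizer (Schur).
[cite: Mazur1997Deformation, §4 Cor. and §11] -/
theorem hasScalarCentralizer_of_isIcosahedralType {F₀ F : Type} [Field F₀] [Field F]
    [NumberField F] [Algebra F₀ F] [IsGalois F₀ F] {p : ℕ} [Fact p.Prime] {𝒪 : Type} [CommRing 𝒪]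
    [IsLocalRing 𝒪] [Algebra ℤ_[p] 𝒪] {k : Type} [Field k] [Algebra 𝒪 k]
    (𝒟 : PolarizedDatum F₀ F p 2 𝒪 k) (ρ₀ : absoluteGaloisGroup F →* GL (Fin 2) 𝒪)
    (hres : 𝒟.residual = (Matrix.GeneralLinearGroup.map (algebraMap 𝒪 k)).comp ρ₀)
    (hρ₀ : IsIcosahedralType ρ₀) (h3 : IsUnit (3 : 𝒪)) : 𝒟.HasScalarCentralizer := by
  refine 𝒟.hasScalarCentralizer_of_span_eq_top ?_
  rw [Literature.RepresentationTheory.Semisimple.span_eq_top_iff_forall_isIrreducible two_pos]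
  intro L _ f
  haveI := isLocalHom_comp_of_surjective (algebraMap 𝒪 k) 𝒟.residueMap_surjective f
  have h := isIrreducible_toStdRepresentation_map_comp (f.comp (algebraMap 𝒪 k)) h3 ρ₀ hρ₀
  rw [Matrix.GeneralLinearGroup.map_comp, MonoidHom.comp_assoc, ← hres] at h
  exact h

/-! ### The coefficient ring `𝒪_E = padicCoeffRing E` -/

section CoeffRing

variable {p : ℕ} [Fact p.Prime]

/-- **`𝒪_E` is a finite `ℤ_p`-module** for `E/ℚ_p` finite: it is the integral closure of `ℤ_p`
in `E` (`mem_padicCoeffRing_iff_isIntegral`), finite by Mathlib's `IsIntegralClosure.finite`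
(finite separable extension of the fraction field of a Noetherian integrally closed domain).
Ref: Serre, *Local Fields*, II §2 Prop. 3. [folklore] -/
theorem moduleFinite_padicCoeffRing (E : IntermediateField ℚ_[p] (PadicAlgCl p))
    [FiniteDimensional ℚ_[p] E] :
    letI : Algebra ℤ_[p] (padicCoeffRing E) := (padicIntToCoeffRing E).toAlgebra
    Module.Finite ℤ_[p] (padicCoeffRing E) := by
  letI : Algebra ℤ_[p] (padicCoeffRing E) := (padicIntToCoeffRing E).toAlgebra
  letI : Algebra ℤ_[p] E := ((algebraMap ℚ_[p] E).comp (algebraMap ℤ_[p] ℚ_[p])).toAlgebra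
  haveI : IsScalarTower ℤ_[p] ℚ_[p] E := IsScalarTower.of_algebraMap_eq fun _ => rfl
  haveI : IsScalarTower ℤ_[p] (padicCoeffRing E) E := IsScalarTower.of_algebraMap_eq fun _ => rfl
  haveI : IsIntegralClosure (padicCoeffRing E) ℤ_[p] E :=
    { algebraMap_injective := fun _ _ h => Subtype.ext h
      isIntegral_iff := fun {x} => by
        rw [← mem_padicCoeffRing_iff_isIntegral]
        exact ⟨fun hx => ⟨⟨x, hx⟩, rfl⟩, by rintro ⟨y, rfl⟩; exact y.2⟩ }
  exact IsIntegralClosure.finite ℤ_[p] ℚ_[p] E (padicCoeffRing E)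

/-- The structure map `ℤ_p → 𝒪_E` is a local homomorphism (it preserves norms, and units are the
elements of norm one on both sides). [folklore] -/
theorem isLocalHom_padicIntToCoeffRing (E : IntermediateField ℚ_[p] (PadicAlgCl p)) :
    IsLocalHom (padicIntToCoeffRing E) := by
  refine ⟨fun z hz => ?_⟩
  rw [isUnit_padicCoeffRing_iff, norm_padicIntToCoeffRing] at hz
  exact PadicInt.isUnit_iff.mpr hz

/-- **The residue field `k_E` of `𝒪_E` is finite** for `E/ℚ_p` finite: `𝒪_E` is a finite
`ℤ_p`-module along the local homomorphism `ℤ_p → 𝒪_E`, so `k_E` is finite over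
`ℤ_p/(p) = 𝔽_p` (Mathlib `IsLocalRing.ResidueField.finite_of_finite`).
Ref: Serre, *Local Fields*, II §2 Prop. 3. [folklore] -/
theorem finite_residueField_padicCoeffRing (E : IntermediateField ℚ_[p] (PadicAlgCl p))
    [FiniteDimensional ℚ_[p] E] :
    letI := isLocalRing_padicCoeffRing E
    Finite (IsLocalRing.ResidueField (padicCoeffRing E)) := by
  letI := isLocalRing_padicCoeffRing E
  letI : Algebra ℤ_[p] (padicCoeffRing E) := (padicIntToCoeffRing E).toAlgebra
  haveI : Module.Finite ℤ_[p] (padicCoeffRing E) := moduleFinite_padicCoeffRing E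
  haveI : IsLocalHom (algebraMap ℤ_[p] (padicCoeffRing E)) := isLocalHom_padicIntToCoeffRing E
  have hfin : Finite (IsLocalRing.ResidueField ℤ_[p]) :=
    Finite.of_equiv _ (PadicInt.residueField (p := p)).toEquiv.symm
  exact IsLocalRing.ResidueField.finite_of_finite (R := ℤ_[p]) (S := padicCoeffRing E) hfin

/-- `𝒪_E → ℚ̄_p` lands in the valuation ring `𝒪_{ℚ̄_p}`. [folklore] -/
theorem padicCoeffRingToPadicAlgCl_mem (E : IntermediateField ℚ_[p] (PadicAlgCl p))
    (x : padicCoeffRing E) :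
    padicCoeffRingToPadicAlgCl E x ∈ (PadicAlgCl.valued p).v.valuationSubring := by
  rw [Valuation.mem_valuationSubring_iff, padicCoeffRingToPadicAlgCl_apply,
    PadicAlgCl.valuation_def, ← NNReal.coe_le_coe, coe_nnnorm, NNReal.coe_one]
  exact norm_coe_padicCoeffRing_le E x

/-- `𝒪_E → ℚ̄_p` is injective. [folklore] -/
theorem padicCoeffRingToPadicAlgCl_injective (E : IntermediateField ℚ_[p] (PadicAlgCl p)) :
    Function.Injective (padicCoeffRingToPadicAlgCl E) :=
  fun _ _ h => Subtype.ext (Subtype.ext h)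

/-- **Integral models over `𝒪_E`.**  A continuous `σ : Γ_K → GL₂(ℚ̄_p)` with finite image is,
after a frame change `P` (the matrix of a `Γ_K`-stable lattice, Serre I.1.1), valued in
`GL₂(𝒪_E)` for a finite extension `E/ℚ_p`: the finitely many matrices `P⁻¹ σ(g) P` have entries
in `𝒪_{ℚ̄_p}` which are algebraic over `ℚ_p`. [cite: SerreAbelianLadic1968, Ch. I §1.1, Remark 1] -/
theorem exists_integralModel_padicCoeffRing {K : Type} [Field K] [NumberField K]
    (σ : FramedGaloisRep K (PadicAlgCl p) 2) (hfin : Finite σ.toMonoidHom.range) :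
    ∃ (E : IntermediateField ℚ_[p] (PadicAlgCl p)) (_ : FiniteDimensional ℚ_[p] E)
      (P : GL (Fin 2) (PadicAlgCl p))
      (ρ₁ : absoluteGaloisGroup K →* GL (Fin 2) (padicCoeffRing E)),
      ∀ g, Matrix.GeneralLinearGroup.map (padicCoeffRingToPadicAlgCl E) (ρ₁ g) = P⁻¹ * σ g * P := by
  -- (a) a stable lattice: an integral model over the open valuation ring `𝒪_{ℚ̄_p}`
  have hOopen : IsOpen (((PadicAlgCl.valued p).v.valuationSubring :
      ValuationSubring (PadicAlgCl p)) : Set (PadicAlgCl p)) :=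
    Valued.isOpen_valuationSubring _
  obtain ⟨P, ρ₀, hρ₀⟩ := exists_integralModel_of_valuationSubring
    (O := (PadicAlgCl.valued p).v.valuationSubring) hOopen σ
  -- (b) a finite extension `E/ℚ_p` containing the entries of the finitely many `P⁻¹ σ(g) P`
  haveI := hfin
  obtain ⟨E, hE, hmem⟩ := exists_finiteDimensional_forall_mem_of_finite (p := p) (n := 2)
    (fun r : σ.toMonoidHom.range =>
      ((P⁻¹ * (r : GL (Fin 2) (PadicAlgCl p)) * P : GL (Fin 2) (PadicAlgCl p)) :
        Matrix (Fin 2) (Fin 2) (PadicAlgCl p)))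
  obtain ⟨φ, hφdef⟩ : ∃ φ : absoluteGaloisGroup K →* GL (Fin 2) (PadicAlgCl p),
      φ = (Matrix.GeneralLinearGroup.map (PadicAlgCl.valued p).v.valuationSubring.subtype).comp ρ₀ :=
    ⟨_, rfl⟩
  have hφ : ∀ g, φ g = P⁻¹ * σ g * P := fun g => by
    rw [hφdef, MonoidHom.comp_apply]
    exact hρ₀ g
  have hφE : ∀ g i j, ((φ g : GL (Fin 2) (PadicAlgCl p)) : Matrix (Fin 2) (Fin 2) (PadicAlgCl p)) i j ∈ E :=
    fun g i j => by
    rw [hφ g]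
    exact hmem ⟨σ g, ⟨g, rfl⟩⟩ i j
  have hφ1 : ∀ g i j, ‖((φ g : GL (Fin 2) (PadicAlgCl p)) : Matrix (Fin 2) (Fin 2) (PadicAlgCl p)) i j‖ ≤ 1 :=
    fun g i j => by
    have hm : ((φ g : GL (Fin 2) (PadicAlgCl p)) : Matrix (Fin 2) (Fin 2) (PadicAlgCl p)) i j ∈
        (PadicAlgCl.valued p).v.valuationSubring := by
      rw [hφdef, MonoidHom.comp_apply, Matrix.GeneralLinearGroup.map_apply]
      exact SetLike.coe_mem _
    rw [Valuation.mem_valuationSubring_iff, PadicAlgCl.valuation_def, ← NNReal.coe_le_coe,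
      coe_nnnorm, NNReal.coe_one] at hm
    exact hm
  -- (c) restrict the codomain to `GL₂(𝒪_E)`
  have key : ∀ g i j, ((φ g : GL (Fin 2) (PadicAlgCl p)) : Matrix (Fin 2) (Fin 2) (PadicAlgCl p)) i j ∈
      Set.range (padicCoeffRingToPadicAlgCl E) := fun g i j =>
    ⟨⟨⟨_, hφE g i j⟩, (mem_padicCoeffRing_iff E _).2 (hφ1 g i j)⟩, rfl⟩
  have hrange : ∀ g, φ g ∈ (Matrix.GeneralLinearGroup.map (padicCoeffRingToPadicAlgCl E)).range :=
    fun g => mem_range_generalLinearGroup_map_of_forall (padicCoeffRingToPadicAlgCl_injective E)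
      (key g) fun i j => by rw [← map_inv]; exact key g⁻¹ i j
  obtain ⟨ρ₁, hρ₁⟩ := exists_monoidHom_map_eq_of_injective (padicCoeffRingToPadicAlgCl E)
    (padicCoeffRingToPadicAlgCl_injective E) φ hrange
  exact ⟨E, hE, P, ρ₁, fun g => (hρ₁ g).trans (hφ g)⟩

end CoeffRing

/-! ### The `2`-adic model -/

/-- `3 = 1 - (-2)` is a unit of the local ring `𝒪_E`, `E/ℚ₂`, since `2 ∈ 𝔪`. [folklore] -/
theorem isUnit_three_padicCoeffRing (E : IntermediateField ℚ_[2] (PadicAlgCl 2)) :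
    IsUnit (3 : padicCoeffRing E) := by
  letI := isLocalRing_padicCoeffRing E
  have h2 : (2 : padicCoeffRing E) ∈ IsLocalRing.maximalIdeal (padicCoeffRing E) := by
    have h := natCast_mem_maximalIdeal_padicCoeffRing (p := 2) E
    rwa [Nat.cast_ofNat] at h
  have hn2 : ¬ IsUnit (-2 : padicCoeffRing E) :=
    (IsLocalRing.mem_maximalIdeal _).mp (neg_mem h2)
  have h := (IsLocalRing.isUnit_or_isUnit_one_sub_self (-2 : padicCoeffRing E)).resolve_left hn2
  have h3 : (1 - (-2) : padicCoeffRing E) = 3 := by norm_num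
  rwa [h3] at h

/-- **Existence of an integral model** `M : Model σ` over `𝒪_E` (for a finite `E/ℚ₂`) of a
continuous `σ : Γ_K → GL₂(ℚ̄₂)` with finite image and projective image `A₅`, whose `σ_𝒪` is
still projectively icosahedral and in whose coefficient ring `3` is a unit.
[cite: SerreAbelianLadic1968, Ch. I §1.1, Remark 1] -/
theorem exists_model {K : Type} [Field K] [NumberField K] (σ : FramedGaloisRep K (PadicAlgCl 2) 2)
    (hfin : Finite σ.toMonoidHom.range)
    (hA5 : Nonempty ((Matrix.ProjGenLinGroup.mk.comp σ.toMonoidHom).range ≃* alternatingGroup (Fin 5))) :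
    ∃ M : Model σ, IsIcosahedralType M.σ𝒪 ∧ IsUnit (3 : M.𝒪) := by
  obtain ⟨E, hE, P, ρ₁, hρ₁⟩ := exists_integralModel_padicCoeffRing σ hfin
  haveI := hE
  letI : IsLocalRing (padicCoeffRing E) := isLocalRing_padicCoeffRing E
  haveI : IsNoetherianRing (padicCoeffRing E) := isNoetherianRing_padicCoeffRing E
  haveI : IsAdicComplete (IsLocalRing.maximalIdeal (padicCoeffRing E)) (padicCoeffRing E) :=
    isAdicComplete_padicCoeffRing E
  haveI : IsDiscreteValuationRing (padicCoeffRing E) := isDiscreteValuationRing_padicCoeffRing E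
  letI : Algebra ℤ_[2] (padicCoeffRing E) := (padicIntToCoeffRing E).toAlgebra
  haveI : CharP (IsLocalRing.ResidueField (padicCoeffRing E)) 2 := charP_residueField_padicCoeffRing E
  haveI : Finite (IsLocalRing.ResidueField (padicCoeffRing E)) := finite_residueField_padicCoeffRing E
  -- the kernel of the model is the (open) kernel of `σ`
  have hinj : Function.Injective
      (Matrix.GeneralLinearGroup.map (n := Fin 2) (padicCoeffRingToPadicAlgCl E)) :=
    generalLinearGroup_map_injective_of_injective _ (padicCoeffRingToPadicAlgCl_injective E)
  have hker : ρ₁.ker = σ.toMonoidHom.ker := by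
    ext g
    rw [MonoidHom.mem_ker, MonoidHom.mem_ker, ← hinj.eq_iff, hρ₁ g, map_one]
    constructor
    · intro h
      calc σ.toMonoidHom g = P * (P⁻¹ * σ g * P) * P⁻¹ := by
            rw [← mul_assoc, ← mul_assoc, mul_inv_cancel, one_mul, mul_assoc, mul_inv_cancel,
              mul_one]; rfl
        _ = 1 := by rw [h, mul_one, mul_inv_cancel]
    · intro h
      have h' : σ g = 1 := h
      rw [h', mul_one, inv_mul_cancel]
  have hopen : IsOpen (ρ₁.ker : Set (absoluteGaloisGroup K)) := by
    rw [hker]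
    haveI := hfin
    exact isOpen_ker_of_finite_range σ
  have hemb : O2.incl.comp ((padicCoeffRingToPadicAlgCl E).codRestrict
      (PadicAlgCl.valued 2).v.valuationSubring (padicCoeffRingToPadicAlgCl_mem E)) =
      padicCoeffRingToPadicAlgCl E :=
    RingHom.ext fun _ => rfl
  refine ⟨{ 𝒪 := padicCoeffRing E
            k := IsLocalRing.ResidueField (padicCoeffRing E)
            residue_surjective := IsLocalRing.residue_surjective
            emb := (padicCoeffRingToPadicAlgCl E).codRestrict (PadicAlgCl.valued 2).v.valuationSubring
              (padicCoeffRingToPadicAlgCl_mem E)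
            emb_injective := fun x y h => by
              have hh := Subtype.ext_iff.mp h
              exact padicCoeffRingToPadicAlgCl_injective E hh
            σ𝒪 := ρ₁
            frame := P
            map_σ𝒪 := fun g => by rw [hemb]; exact hρ₁ g
            isOpen_ker := hopen
            isOpen_ker_residual := Subgroup.isOpen_mono (fun g hg => by
              rw [MonoidHom.mem_ker] at hg ⊢
              rw [MonoidHom.comp_apply, hg, map_one]) hopen }, ?_, isUnit_three_padicCoeffRing E⟩
  exact isIcosahedralType_of_map_eq_conj _ (padicCoeffRingToPadicAlgCl_injective E) σ.toMonoidHom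
    ρ₁ P hρ₁ hA5

/-! ### The stub -/

/-- STUB (setup; theorem-sized) `stub_setup` — **integral model and universal ring exist.**  A
continuous `σ : Γ_K → GL₂(ℚ̄₂)` with finite image takes values in `GL₂(𝒪_E)` for a finite
extension `E/ℚ₂` (its finitely many entries are algebraic over `ℚ₂`), `𝒪 = 𝒪_E` is a complete
Noetherian local `ℤ₂`-algebra with finite residue field `k` of characteristic `2`, `σ_𝒪` and its
reduction `σ̄` have open kernels; `σ̄` with projective image `A₅` is absolutely irreducible, so has
scalar centralizer (Schur), and Mazur's universal deformation ring of `σ̄` unramified outside the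
bad set exists (the tree's PROVED `polarizedDeformationRing_nonempty_holds`, `Θ = ∅`).
[cite: Mazur1997Deformation, §20 Prop. 2 and §26 Prop. 1] [difficulty: M] -/
theorem stub_setup : ∀ (K : Type) [Field K] [NumberField K]
    (σ : FramedGaloisRep K (PadicAlgCl 2) 2),
    Finite σ.toMonoidHom.range → σ.toGaloisRep.IsIrreducible →
    Nonempty ((Matrix.ProjGenLinGroup.mk.comp σ.toMonoidHom).range ≃* alternatingGroup (Fin 5)) →
    ∃ M : Model σ, ∀ (S₀ : Finset ℕ) (h0 : (0 : ℕ) ∉ S₀) (h2 : 2 ∈ S₀)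
      (hunr : ∀ v ∉ badSet K S₀, Deformation.IsUnramifiedAt v M.residual),
      Nonempty (PolarizedDeformationRing (M.datum S₀ h0 h2 hunr)) := by
  intro K _ _ σ hfin _ hA5
  obtain ⟨M, hIco, h3⟩ := exists_model σ hfin hA5
  refine ⟨M, fun S₀ h0 h2 hunr => ?_⟩
  have hSchur : (M.datum S₀ h0 h2 hunr).HasScalarCentralizer :=
    hasScalarCentralizer_of_isIcosahedralType (M.datum S₀ h0 h2 hunr) M.σ𝒪 rfl hIco h3
  exact polarizedDeformationRing_nonempty_holds K K 2 2 M.𝒪 M.k (M.datum S₀ h0 h2 hunr) hSchur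

end Summit.Langlands.Langlands.Cruxes.TwoAdicBianchiProModularityLevel.DimensionSqueeze

end
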